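import Summits.CriticalPhenomena.PercolationContinuityZ3.Theorems.PercNearOneGluingNoHeavyLowerTailForestRayleighTools
import HarnessLib

/-!
# Weighted forest negative correlation on graphs of tree-width ≤ 2 — IIb: series vertex carrying `e`, second edge free

Notation as in `…ForestRayleighTools`: `Z(D;K) = Σ_{G ⊆ D, ⟨G ∪ K⟩ acyclic} ∏_{g∈G} w g` and the
Rayleigh inequality `(R)(D;K;e,f) : Z(D;K∪{e,f})·Z(D;K) ≤ Z(D;K∪{e})·Z(D;K∪{f})`.

This file treats the series vertex `v` (degree two in `E = D ∪ K ∪ {e,f}`) whose first edge is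
`e = vu₁` and whose second edge `vu₂` is FREE (in `D`): `(R)` for `E` follows from `(R)` for the
instance obtained by replacing the path `u₁ v u₂` by the chord `u₁u₂` (absorbing the chord's
activity if it is already present). Companion of `…ForestRayleighSteps` (pendant vertex; series
vertex with the second edge pinned); Semple–Welsh, *Negative correlation in graphs and matroids*,
CPC 17 (2008), Prop. 3.7, in graph language. Theorems only; no definitions, no `sorry`.
-/

open Finset SimpleGraph
open scoped Classical

namespace Summit.CriticalPhenomena.PercolationContinuityZ3.Theorems.ForestRayleigh

variable {V : Type*} [Fintype V] [DecidableEq V]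

omit [Fintype V] [DecidableEq V] in
/-- Real-algebra step: `p (a + t a) ≤ a (p + t p)` (equality). [elementary] -/
theorem real_scale_le {p a t : ℝ} : p * (a + t * a) ≤ a * (p + t * p) := le_of_eq (by ring)

omit [Fintype V] [DecidableEq V] in
/-- Real-algebra step: `p (a + t a) ≤ (a + t p)(p + t p)` for `t ≥ 0`. [elementary] -/
theorem real_tri_le {p a t : ℝ} (ht : 0 ≤ t) : p * (a + t * a) ≤ (a + t * p) * (p + t * p) := by
  nlinarith [mul_nonneg ht (mul_self_nonneg p), mul_nonneg (mul_nonneg ht ht) (mul_self_nonneg p)]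

omit [Fintype V] [DecidableEq V] in
/-- Real-algebra step of the series reduction: `P A ≤ B C`, `t ≥ 0` give
`(C + tP)(A + tA) ≤ (A + tB)(C + tC)`. [elementary] -/
theorem real_series_le {P A B C t : ℝ} (h : P * A ≤ B * C) (ht : 0 ≤ t) :
    (C + t * P) * (A + t * A) ≤ (A + t * B) * (C + t * C) := by
  have e : (A + t * B) * (C + t * C) - (C + t * P) * (A + t * A) = (1 + t) * t * (B * C - P * A) := by
    ring
  nlinarith [mul_nonneg (mul_nonneg (by linarith : (0:ℝ) ≤ 1 + t) ht) (sub_nonneg.2 h), e]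

omit [Fintype V] [DecidableEq V] in
/-- Real-algebra step of the series reduction with an absorbed chord: `P A ≤ B C`, `t ≥ 0` give
`((C + sP) + tP)((A + sB) + t(A + sB)) ≤ ((A + sB) + tB)((C + sP) + t(C + sP))`. [elementary] -/
theorem real_series_absorb_le {P A B C s t : ℝ} (h : P * A ≤ B * C) (ht : 0 ≤ t) :
    ((C + s * P) + t * P) * ((A + s * B) + t * (A + s * B)) ≤
      ((A + s * B) + t * B) * ((C + s * P) + t * (C + s * P)) := by
  have e : ((A + s * B) + t * B) * ((C + s * P) + t * (C + s * P)) -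
      ((C + s * P) + t * P) * ((A + s * B) + t * (A + s * B)) =
        (1 + t) * t * (B * C - P * A) := by ring
  nlinarith [mul_nonneg (mul_nonneg (by linarith : (0:ℝ) ≤ 1 + t) ht) (sub_nonneg.2 h), e]

/-- **Degree-two vertex carrying `e = vu₁`, the other edge `vu₂` free.** With `h = u₁u₂` the
chord: `(R)(D₀ ∪ vu₂;K;vu₁,f)` follows from `(R)(D₀ ∖ h;K;h,f)` (needed only when `h ∉ K`, `h ≠ f`).
[S–W Prop. 3.7, case `|{b,c} ∩ {e,f}| = 1`] -/
theorem lsm_series_free (w : Sym2 V → ℝ) (hw : ∀ x, 0 ≤ w x) (D₀ K : Finset (Sym2 V)) (f : Sym2 V)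
    {v u₁ u₂ : V} (hDK : ∀ x ∈ D₀ ∪ insert s(v, u₁) (insert f (insert s(v, u₂) K)), ¬x.IsDiag)
    (hv : ∀ x ∈ D₀ ∪ insert f K, v ∉ x) (hu : u₁ ≠ u₂) (hfD : f ∉ D₀) (hfK : f ∉ K)
    (hred : s(u₁, u₂) ∉ K → s(u₁, u₂) ≠ f →
      (∑ G ∈ (D₀.erase s(u₁, u₂)).powerset.filter (fun G =>
        (fromEdgeSet ((G ∪ (insert s(u₁, u₂) (insert f K)) : Finset (Sym2 V)) : Set (Sym2 V))).IsAcyclic), ∏ x ∈ G, w x) *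
      (∑ G ∈ (D₀.erase s(u₁, u₂)).powerset.filter (fun G =>
        (fromEdgeSet ((G ∪ K : Finset (Sym2 V)) : Set (Sym2 V))).IsAcyclic), ∏ x ∈ G, w x) ≤
    (∑ G ∈ (D₀.erase s(u₁, u₂)).powerset.filter (fun G =>
        (fromEdgeSet ((G ∪ (insert s(u₁, u₂) K) : Finset (Sym2 V)) : Set (Sym2 V))).IsAcyclic), ∏ x ∈ G, w x) *
      (∑ G ∈ (D₀.erase s(u₁, u₂)).powerset.filter (fun G =>
        (fromEdgeSet ((G ∪ (insert f K) : Finset (Sym2 V)) : Set (Sym2 V))).IsAcyclic), ∏ x ∈ G, w x)) :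
    (∑ G ∈ (insert s(v, u₂) D₀).powerset.filter (fun G =>
        (fromEdgeSet ((G ∪ (insert s(v, u₁) (insert f K)) : Finset (Sym2 V)) : Set (Sym2 V))).IsAcyclic), ∏ x ∈ G, w x) *
      (∑ G ∈ (insert s(v, u₂) D₀).powerset.filter (fun G =>
        (fromEdgeSet ((G ∪ K : Finset (Sym2 V)) : Set (Sym2 V))).IsAcyclic), ∏ x ∈ G, w x) ≤
    (∑ G ∈ (insert s(v, u₂) D₀).powerset.filter (fun G =>
        (fromEdgeSet ((G ∪ (insert s(v, u₁) K) : Finset (Sym2 V)) : Set (Sym2 V))).IsAcyclic), ∏ x ∈ G, w x) *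
      (∑ G ∈ (insert s(v, u₂) D₀).powerset.filter (fun G =>
        (fromEdgeSet ((G ∪ (insert f K) : Finset (Sym2 V)) : Set (Sym2 V))).IsAcyclic), ∏ x ∈ G, w x) := by
  have hvu₁ : v ≠ u₁ := fun hh => hDK s(v, u₁) (by simp) (Sym2.mk_isDiag_iff.2 hh)
  have hvu₂ : v ≠ u₂ := fun hh => hDK s(v, u₂) (by simp) (Sym2.mk_isDiag_iff.2 hh)
  have hvf : v ∉ f := hv f (by simp)
  have heD : s(v, u₁) ∉ D₀ := fun hh =>
    hv s(v, u₁) (Finset.mem_union_left _ hh) (Sym2.mem_mk_left _ _)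
  have heK : s(v, u₁) ∉ K := fun hh =>
    hv s(v, u₁) (Finset.mem_union_right _ (Finset.mem_insert_of_mem hh)) (Sym2.mem_mk_left _ _)
  have hgD : s(v, u₂) ∉ D₀ := fun hh =>
    hv s(v, u₂) (Finset.mem_union_left _ hh) (Sym2.mem_mk_left _ _)
  have hgK : s(v, u₂) ∉ K := fun hh =>
    hv s(v, u₂) (Finset.mem_union_right _ (Finset.mem_insert_of_mem hh)) (Sym2.mem_mk_left _ _)
  have hef : s(v, u₁) ≠ f := fun hh => hvf (hh ▸ Sym2.mem_mk_left _ _)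
  have hgf : s(v, u₂) ≠ f := fun hh => hvf (hh ▸ Sym2.mem_mk_left _ _)
  have hge : s(v, u₂) ≠ s(v, u₁) := fun hh => hu (Sym2.congr_right.1 hh).symm
  have hvh : v ∉ s(u₁, u₂) := by
    rw [Sym2.mem_iff]; rintro (hh | hh) <;> [exact hvu₁ hh; exact hvu₂ hh]
  have hhe : s(u₁, u₂) ≠ s(v, u₁) := fun hh => hvh (hh ▸ Sym2.mem_mk_left _ _)
  have hhg : s(u₁, u₂) ≠ s(v, u₂) := fun hh => hvh (hh ▸ Sym2.mem_mk_left _ _)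
  have hnd : ¬(s(u₁, u₂) : Sym2 V).IsDiag := fun hh => hu (Sym2.mk_isDiag_iff.1 hh)
  -- restrictions of the hypotheses
  have nd₀ : ∀ x ∈ D₀ ∪ K, ¬x.IsDiag := fun x hx => hDK x (by
    simp only [Finset.mem_union, Finset.mem_insert] at hx ⊢; tauto)
  have ndf : ∀ x ∈ D₀ ∪ insert f K, ¬x.IsDiag := fun x hx => hDK x (by
    simp only [Finset.mem_union, Finset.mem_insert] at hx ⊢; tauto)
  have nde : ∀ x ∈ D₀ ∪ insert s(v, u₁) K, ¬x.IsDiag := fun x hx => hDK x (by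
    simp only [Finset.mem_union, Finset.mem_insert] at hx ⊢; tauto)
  have ndef : ∀ x ∈ D₀ ∪ insert s(v, u₁) (insert f K), ¬x.IsDiag := fun x hx => hDK x (by
    simp only [Finset.mem_union, Finset.mem_insert] at hx ⊢; tauto)
  have hv₀ : ∀ x ∈ D₀ ∪ K, v ∉ x := fun x hx => hv x (by
    simp only [Finset.mem_union, Finset.mem_insert] at hx ⊢; tauto)
  -- split off the free edge `vu₂` and drop the pendant copies of `vu₁`, `vu₂`
  rw [forestsW_insert_split w D₀ _ hgD, forestsW_insert_split w D₀ _ hgD,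
    forestsW_insert_split w D₀ _ hgD, forestsW_insert_split w D₀ _ hgD,
    forestsW_pin_pendant w D₀ K nd₀ hv₀ hvu₂.symm,
    forestsW_pin_pendant w D₀ (insert f K) ndf hv hvu₂.symm,
    forestsW_pin_pendant w D₀ K nd₀ hv₀ hvu₁.symm,
    forestsW_pin_pendant w D₀ (insert f K) ndf hv hvu₁.symm]
  -- loop-freeness of the pinned sets containing `e` and `vu₂`
  have nd₁ : ∀ x ∈ insert s(v, u₂) (insert s(v, u₁) K), ¬x.IsDiag := by
    intro x hx
    apply hDK x
    simp only [Finset.mem_union, Finset.mem_insert] at hx ⊢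
    rcases hx with hx | hx | hx
    · exact Or.inr (Or.inr (Or.inr (Or.inl hx)))
    · exact Or.inr (Or.inl hx)
    · exact Or.inr (Or.inr (Or.inr (Or.inr hx)))
  have nd₂ : ∀ x ∈ insert s(v, u₂) (insert s(v, u₁) (insert f K)), ¬x.IsDiag := by
    intro x hx
    apply hDK x
    simp only [Finset.mem_union, Finset.mem_insert] at hx ⊢
    rcases hx with hx | hx | hx | hx
    · exact Or.inr (Or.inr (Or.inr (Or.inl hx)))
    · exact Or.inr (Or.inl hx)
    · exact Or.inr (Or.inr (Or.inl hx))
    · exact Or.inr (Or.inr (Or.inr (Or.inr hx)))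
  by_cases hK : s(u₁, u₂) ∈ K
  · -- pinned triangle
    rw [forestsW_eq_zero_of_triangle w D₀ _ nd₁ (a := v) (b := u₁) (c := u₂) (by simp)
        (by simp [hK]) (by simp) hvu₁ hu hvu₂,
      forestsW_eq_zero_of_triangle w D₀ _ nd₂ (a := v) (b := u₁) (c := u₂) (by simp)
        (by simp [hK]) (by simp) hvu₁ hu hvu₂]
    simp only [mul_zero, add_zero]
    exact real_scale_le
  by_cases hf : s(u₁, u₂) = f
  · -- `vu₂` re-routes onto `f`; the doubly pinned set contains the triangle
    have r₁ := forestsW_pin_reroute w D₀ (insert s(v, u₁) K) nde (Finset.mem_insert_self _ _) hvu₂ hu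
      (by
        simp only [Finset.mem_union, Finset.mem_insert, not_or]
        exact ⟨hgD, hge, hgK⟩)
      (by
        rw [hf]; simp only [Finset.mem_union, Finset.mem_insert, not_or]
        exact ⟨hfD, Ne.symm hef, hfK⟩)
    have hvhK : ∀ x ∈ D₀ ∪ insert s(u₁, u₂) K, v ∉ x := by
      intro x hx
      rcases Finset.mem_union.1 hx with hx | hx
      · exact hv₀ x (Finset.mem_union_left _ hx)
      · rcases Finset.mem_insert.1 hx with rfl | hx
        · exact hvh
        · exact hv₀ x (Finset.mem_union_right _ hx)
    have ndh : ∀ x ∈ D₀ ∪ insert s(u₁, u₂) K, ¬x.IsDiag := by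
      intro x hx
      rcases Finset.mem_union.1 hx with hx | hx
      · exact nd₀ x (Finset.mem_union_left _ hx)
      · rcases Finset.mem_insert.1 hx with rfl | hx
        · exact hnd
        · exact nd₀ x (Finset.mem_union_right _ hx)
    rw [Finset.insert_comm s(u₁, u₂) s(v, u₁) K, forestsW_pin_pendant w D₀ (insert s(u₁, u₂) K) ndh hvhK hvu₁.symm,
      hf] at r₁
    rw [r₁, forestsW_eq_zero_of_triangle w D₀ _ nd₂ (a := v) (b := u₁) (c := u₂) (by simp)
        (by rw [hf]; simp) (by simp) hvu₁ hu hvu₂]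
    simp only [mul_zero, add_zero]
    exact real_tri_le (hw s(v, u₂))
  -- from here on `h ∉ K`, `h ≠ f`: re-route `vu₂` onto the chord `h`
  have spec := hred hK hf
  by_cases hD : s(u₁, u₂) ∈ D₀
  · -- `h ∈ D₀`: split off `h` as well
    have hD' : D₀ = insert s(u₁, u₂) (D₀.erase s(u₁, u₂)) := (Finset.insert_erase hD).symm
    have hh₁ : s(u₁, u₂) ∉ D₀.erase s(u₁, u₂) := Finset.notMem_erase _ _
    have sub₁ : D₀.erase s(u₁, u₂) ⊆ D₀ := Finset.erase_subset _ _
    have nd₄ : ∀ x ∈ D₀.erase s(u₁, u₂) ∪ insert s(v, u₁) K, ¬x.IsDiag := fun x hx =>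
      nde x (Finset.union_subset_union sub₁ (subset_refl _) hx)
    have nd₅ : ∀ x ∈ D₀.erase s(u₁, u₂) ∪ insert s(v, u₁) (insert f K), ¬x.IsDiag := fun x hx =>
      ndef x (Finset.union_subset_union sub₁ (subset_refl _) hx)
    have ndh : ∀ x ∈ D₀.erase s(u₁, u₂) ∪ insert s(u₁, u₂) K, ¬x.IsDiag := by
      intro x hx
      rcases Finset.mem_union.1 hx with hx | hx
      · exact nd₀ x (Finset.mem_union_left _ (sub₁ hx))
      · rcases Finset.mem_insert.1 hx with rfl | hx
        · exact hnd
        · exact nd₀ x (Finset.mem_union_right _ hx)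
    have ndhf : ∀ x ∈ D₀.erase s(u₁, u₂) ∪ insert s(u₁, u₂) (insert f K), ¬x.IsDiag := by
      intro x hx
      rcases Finset.mem_union.1 hx with hx | hx
      · exact ndf x (Finset.mem_union_left _ (sub₁ hx))
      · rcases Finset.mem_insert.1 hx with rfl | hx
        · exact hnd
        · exact ndf x (Finset.mem_union_right _ hx)
    have hvh₀ : ∀ x ∈ D₀.erase s(u₁, u₂) ∪ insert s(u₁, u₂) K, v ∉ x := by
      intro x hx
      rcases Finset.mem_union.1 hx with hx | hx
      · exact hv₀ x (Finset.mem_union_left _ (sub₁ hx))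
      · rcases Finset.mem_insert.1 hx with rfl | hx
        · exact hvh
        · exact hv₀ x (Finset.mem_union_right _ hx)
    have hvhf : ∀ x ∈ D₀.erase s(u₁, u₂) ∪ insert s(u₁, u₂) (insert f K), v ∉ x := by
      intro x hx
      rcases Finset.mem_union.1 hx with hx | hx
      · exact hv₀ x (Finset.mem_union_left _ (sub₁ hx))
      · rcases Finset.mem_insert.1 hx with rfl | hx
        · exact hvh
        · exact hv x (Finset.mem_union_right _ hx)
    have r₁ := forestsW_pin_reroute w (D₀.erase s(u₁, u₂)) (insert s(v, u₁) K) nd₄ (Finset.mem_insert_self _ _)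
      hvu₂ hu
      (by
        simp only [Finset.mem_union, Finset.mem_insert, not_or]
        exact ⟨fun hh => hgD (sub₁ hh), hge, hgK⟩)
      (by
        simp only [Finset.mem_union, Finset.mem_insert, not_or]
        exact ⟨hh₁, hhe, hK⟩)
    rw [Finset.insert_comm s(u₁, u₂) s(v, u₁) K,
      forestsW_pin_pendant w (D₀.erase s(u₁, u₂)) (insert s(u₁, u₂) K) ndh hvh₀ hvu₁.symm] at r₁
    have r₂ := forestsW_pin_reroute w (D₀.erase s(u₁, u₂)) (insert s(v, u₁) (insert f K)) nd₅
      (Finset.mem_insert_self _ _) hvu₂ hu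
      (by
        simp only [Finset.mem_union, Finset.mem_insert, not_or]
        exact ⟨fun hh => hgD (sub₁ hh), hge, hgf, hgK⟩)
      (by
        simp only [Finset.mem_union, Finset.mem_insert, not_or]
        exact ⟨hh₁, hhe, hf, hK⟩)
    rw [Finset.insert_comm s(u₁, u₂) s(v, u₁) (insert f K),
      forestsW_pin_pendant w (D₀.erase s(u₁, u₂)) (insert s(u₁, u₂) (insert f K)) ndhf hvhf hvu₁.symm] at r₂
    -- pinned triangles `h, vu₂, e`
    have nd₆ : ∀ x ∈ insert s(u₁, u₂) (insert s(v, u₂) (insert s(v, u₁) K)), ¬x.IsDiag := by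
      intro x hx
      rcases Finset.mem_insert.1 hx with rfl | hx
      · exact hnd
      · exact nd₁ x hx
    have nd₇ : ∀ x ∈ insert s(u₁, u₂) (insert s(v, u₂) (insert s(v, u₁) (insert f K))), ¬x.IsDiag := by
      intro x hx
      rcases Finset.mem_insert.1 hx with rfl | hx
      · exact hnd
      · exact nd₂ x hx
    have t₁ := forestsW_eq_zero_of_triangle w (D₀.erase s(u₁, u₂)) _ nd₆ (a := v) (b := u₁) (c := u₂)
      (by simp) (by simp) (by simp) hvu₁ hu hvu₂
    have t₂ := forestsW_eq_zero_of_triangle w (D₀.erase s(u₁, u₂)) _ nd₇ (a := v) (b := u₁) (c := u₂)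
      (by simp) (by simp) (by simp) hvu₁ hu hvu₂
    rw [hD', forestsW_insert_split w _ _ hh₁, forestsW_insert_split w _ _ hh₁,
      forestsW_insert_split w _ _ hh₁, forestsW_insert_split w _ _ hh₁, r₁, r₂, t₁, t₂]
    simp only [mul_zero, add_zero]
    exact real_series_absorb_le spec (hw s(v, u₂))
  · -- `h ∉ D₀`: plain re-routing
    rw [Finset.erase_eq_of_notMem hD] at spec
    have hvh₀ : ∀ x ∈ D₀ ∪ insert s(u₁, u₂) K, v ∉ x := by
      intro x hx
      rcases Finset.mem_union.1 hx with hx | hx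
      · exact hv₀ x (Finset.mem_union_left _ hx)
      · rcases Finset.mem_insert.1 hx with rfl | hx
        · exact hvh
        · exact hv₀ x (Finset.mem_union_right _ hx)
    have hvhf : ∀ x ∈ D₀ ∪ insert s(u₁, u₂) (insert f K), v ∉ x := by
      intro x hx
      rcases Finset.mem_union.1 hx with hx | hx
      · exact hv₀ x (Finset.mem_union_left _ hx)
      · rcases Finset.mem_insert.1 hx with rfl | hx
        · exact hvh
        · exact hv x (Finset.mem_union_right _ hx)
    have ndh : ∀ x ∈ D₀ ∪ insert s(u₁, u₂) K, ¬x.IsDiag := by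
      intro x hx
      rcases Finset.mem_union.1 hx with hx | hx
      · exact nd₀ x (Finset.mem_union_left _ hx)
      · rcases Finset.mem_insert.1 hx with rfl | hx
        · exact hnd
        · exact nd₀ x (Finset.mem_union_right _ hx)
    have ndhf : ∀ x ∈ D₀ ∪ insert s(u₁, u₂) (insert f K), ¬x.IsDiag := by
      intro x hx
      rcases Finset.mem_union.1 hx with hx | hx
      · exact ndf x (Finset.mem_union_left _ hx)
      · rcases Finset.mem_insert.1 hx with rfl | hx
        · exact hnd
        · exact ndf x (Finset.mem_union_right _ hx)
    have r₁ := forestsW_pin_reroute w D₀ (insert s(v, u₁) K) nde (Finset.mem_insert_self _ _) hvu₂ hu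
      (by
        simp only [Finset.mem_union, Finset.mem_insert, not_or]
        exact ⟨hgD, hge, hgK⟩)
      (by
        simp only [Finset.mem_union, Finset.mem_insert, not_or]
        exact ⟨hD, hhe, hK⟩)
    rw [Finset.insert_comm s(u₁, u₂) s(v, u₁) K, forestsW_pin_pendant w D₀ (insert s(u₁, u₂) K) ndh hvh₀ hvu₁.symm]
      at r₁
    have r₂ := forestsW_pin_reroute w D₀ (insert s(v, u₁) (insert f K)) ndef (Finset.mem_insert_self _ _)
      hvu₂ hu
      (by
        simp only [Finset.mem_union, Finset.mem_insert, not_or]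
        exact ⟨hgD, hge, hgf, hgK⟩)
      (by
        simp only [Finset.mem_union, Finset.mem_insert, not_or]
        exact ⟨hD, hhe, hf, hK⟩)
    rw [Finset.insert_comm s(u₁, u₂) s(v, u₁) (insert f K),
      forestsW_pin_pendant w D₀ (insert s(u₁, u₂) (insert f K)) ndhf hvhf hvu₁.symm] at r₂
    rw [r₁, r₂]
    exact real_series_le spec (hw s(v, u₂))


end Summit.CriticalPhenomena.PercolationContinuityZ3.Theorems.ForestRayleigh
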